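import Mathlib
import Summits.Schanuel.Schanuel.Theses.RigidCore
import Summits.Schanuel.Schanuel.Theses.GaussianStokesSector
import Summits.Schanuel.Schanuel.Theorems.RigidCoreDefs
import Summits.Schanuel.Schanuel.Theorems.RigidCoreSchanuelOnLogFreeCoreSplitExact
import Summits.Schanuel.Schanuel.Theorems.RigidCoreSchanuelOnLogFreeCoreRelLWStepOfCrux
import Summits.Schanuel.Schanuel.Theorems.AclSubsetLogFreeCore.Negative.LogFreeCoreCountable
import Literature.NumberTheory.Transcendental.GammaFields
import Literature.NumberTheory.Transcendental.GammaFieldsEcl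
import Literature.NumberTheory.Transcendental.GammaStrongDescent
import Literature.NumberTheory.Transcendental.ZilberFieldHomogeneity

/-!
# Line `sector-split` (route `RigidCore`): exactness, `(R) ⟹` core-relative Schanuel over the π–LW field

Prover file for the registered stub `stub_coreRel_of_crux` of line `sector-split` of crux
`stmt-Schanuel-0970` (`Summit.Schanuel.Schanuel.Theses.RigidCore.SchanuelOnLogFreeCore`, "(R)":
Schanuel's statement for `ℚ`-linearly independent tuples from the log-free core
`C_EA = sInf {K | 2πi ∈ K, K exp-closed, K relatively algebraically closed in ℂ}` = `eaFibre (2πi)`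
= `logFreeCore`).

The line (crux-strategist's split (S), `Cruxes/SchanuelOnLogFreeCore/STRATEGY-CENSUS.md` §4)
splits (R) along the `ℚ`-subspace `V₂ = E := span_ℚ(ℚ̄ ∪ {πi})` of the core, over the π–LW field
`K₂ = L := ℚ(ℚ̄ ∪ {πi} ∪ e^{ℚ̄})`:
* residue 1 = `GaussianStokesSector.PiFreeOverLWField` (item stmt-Schanuel-9545) — the INSIDE count;
* residue 2 = "CoreRel": for core tuples `x` that are `ℚ`-free modulo `E`,
  `n ≤ trdeg_L L(x, eˣ)` — item stmt-Schanuel-9548 `RelSchanuelOverPiLWField` restricted to core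
  tuples — the OUTSIDE count.
The glue `stub_sectorGlue` (residue 1 → residue 2 → (R)) and `(R) ⟹ residue 1` are landed
(`RigidCoreSchanuelOnLogFreeCoreSectorGlue`, `…PiFreeOfStageZero`).  This file proves the remaining
EXACTNESS half

  **`(R) ⟹ CoreRel`** (`stub_coreRel_of_crux`, signature verbatim),

so that `(R) ⟺ PiFreeOverLWField ∧ CoreRel` is kernel-exact.

Proof (`SectorExact.le_trdeg_of_crux`) — the hull count of `RelLWStep.le_trdeg_of_crux`
(`RigidCoreSchanuelOnLogFreeCoreRelLWStepOfCrux`, Bays–Kirby arXiv:1512.04262 §9 predimension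
calculus, tree `Literature.NumberTheory.Transcendental.GammaField`) with the level `stage m`
replaced by the subspace `E` and the field `stage (m+1)` by `L`:
1. `trdeg_L L(T) = relRank (L / T) = relRank (G / T)` for `T = x ∪ eˣ` and the generator SET
   `G = ℚ̄ ∪ {πi} ∪ e^{ℚ̄}` of `L` (`toENat_trdeg_adjoin_eq_relRank`, `acl_adjoin`); take a basis `J`
   of `T` over `G` in the algebraic matroid and, by finite character, a finite `I ⊆ J ∪ G` with
   `T ⊆ acl I`.
2. HULLS INSIDE `E` (`δ = 0`, finitely generated, `≤ E`) of the three kinds of generators are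
   immediate: an algebraic number has hull `0`; `πi` has hull `ℚπi` (`e^{πi} = −1`, so
   `td ≤ 1 = ldim`, and `δ ≥ 0` by (R)); `e^c` with `c` algebraic has hull `ℚc` (`c ∈ acl ∅`).
   Finitely many hulls have a common hull `V ≤ E` (`RelLWStep.exists_common_hull`, which uses
   `δ ≥ 0` on finitely generated subspaces of the core, i.e. (R)).
3. COUNT: `n = ldim(X/E) ≤ ldim(X/V) ≤ td(X/V) ≤ relRank(T / gens V) ≤ |J| = trdeg_L L(T)` for
   `X = span x` (`δ(X/V) ≥ 0` from (R) since `δ(V/0) = 0`).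
No new definitions; everything used is proved in the tree; (R) is the hypothesis.
-/

noncomputable section

namespace Summit.Schanuel.Schanuel.Theorems.RigidCore

open Set Literature.NumberTheory.Transcendental Literature.NumberTheory.Transcendental.GammaField
open Summit.Schanuel.Schanuel.Theses.RigidCore (SchanuelOnLogFreeCore)
open Summit.Schanuel.Schanuel.Theorems.AclSubsetLogFreeCore.Negative
  (logFreeCore logFreeCore_mem_coreFamily two_pi_I_mem_logFreeCore)

namespace SectorExact

/-! ## The subspace `E = span(ℚ̄ ∪ {πi})` lies in the core -/

/-- An algebraic number lies in every relative algebraic closure `acl s`. [folklore] -/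
theorem mem_acl_of_isAlgebraic_rat {c : ℂ} (hc : IsAlgebraic ℚ c) (s : Set ℂ) : c ∈ acl s := by
  rw [mem_acl_iff]
  exact hc.extendScalars (RingHom.injective _)

/-- Algebraic numbers lie in the log-free core `C_EA` (it is relatively algebraically closed).
[folklore] -/
theorem mem_eaFibre_of_isAlgebraic {z : ℂ} (hz : IsAlgebraic ℚ z) :
    z ∈ eaFibre (2 * ↑Real.pi * Complex.I) := by
  rw [RelLWStep.eaFibre_eq_logFreeCore]
  exact logFreeCore_mem_coreFamily.2.2 z (hz.tower_top (L := ↥logFreeCore))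

/-- `πi = 2πi / 2` lies in the log-free core `C_EA`. [folklore] -/
theorem pi_mul_I_mem_eaFibre : (Real.pi : ℂ) * Complex.I ∈ eaFibre (2 * ↑Real.pi * Complex.I) := by
  have h2 : (2 * ↑Real.pi * Complex.I : ℂ) ∈ eaFibre (2 * ↑Real.pi * Complex.I) := by
    rw [RelLWStep.eaFibre_eq_logFreeCore]; exact two_pi_I_mem_logFreeCore
  have h : (Real.pi : ℂ) * Complex.I = ((1 / 2 : ℚ) : ℂ) * (2 * ↑Real.pi * Complex.I) := by
    push_cast; ring
  rw [h]
  exact mul_mem (SubfieldClass.ratCast_mem _ _) h2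

/-- `E = span_ℚ(ℚ̄ ∪ {πi}) ≤ C_EA` as `ℚ`-subspaces. [folklore] -/
theorem span_alg_pi_le_eaFibre :
    Submodule.span ℚ ({z : ℂ | IsAlgebraic ℚ z} ∪ {(Real.pi : ℂ) * Complex.I}) ≤
      Subalgebra.toSubmodule (eaFibre (2 * ↑Real.pi * Complex.I)).toSubalgebra := by
  rw [Submodule.span_le]
  rintro z (hz | hz)
  · exact mem_eaFibre_of_isAlgebraic hz
  · rw [mem_singleton_iff] at hz
    rw [hz]
    exact pi_mul_I_mem_eaFibre

/-! ## Hulls inside `E` of the generators of the π–LW field -/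

/-- Hull of an algebraic number: the zero subspace. [folklore] -/
theorem exists_hull_of_isAlgebraic {z : ℂ} (hz : IsAlgebraic ℚ z) :
    ∃ V : Submodule ℚ ℂ, V ≤ Submodule.span ℚ ({z : ℂ | IsAlgebraic ℚ z} ∪ {(Real.pi : ℂ) * Complex.I}) ∧
      IsFG (⊥ : Submodule ℚ ℂ) V ∧ predim ⊥ V = 0 ∧ z ∈ acl (gens V) :=
  ⟨⊥, bot_le, isFG_self ⊥, predim_self ⊥, mem_acl_of_isAlgebraic_rat hz _⟩

/-- Hull of `πi`: the line `ℚπi` (`e^{πi} = −1` gives `td ≤ 1`, so `δ ≤ 0`; `δ ≥ 0` by (R)).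
[cite: BaysKirby2018ANT, §9] -/
theorem exists_hull_pi_mul_I (hR : SchanuelOnLogFreeCore) :
    ∃ V : Submodule ℚ ℂ, V ≤ Submodule.span ℚ ({z : ℂ | IsAlgebraic ℚ z} ∪ {(Real.pi : ℂ) * Complex.I}) ∧
      IsFG (⊥ : Submodule ℚ ℂ) V ∧ predim ⊥ V = 0 ∧ (Real.pi : ℂ) * Complex.I ∈ acl (gens V) := by
  set τ : ℂ := (Real.pi : ℂ) * Complex.I with hτ
  have hVE : Submodule.span ℚ {τ} ≤
      Submodule.span ℚ ({z : ℂ | IsAlgebraic ℚ z} ∪ {(Real.pi : ℂ) * Complex.I}) :=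
    (Submodule.span_singleton_le_iff_mem _ _).2 (Submodule.subset_span (Or.inr rfl))
  have hVfg : IsFG (⊥ : Submodule ℚ ℂ) (Submodule.span ℚ {τ}) :=
    isFG_span_of_finite ⊥ (finite_singleton τ)
  have hexp : (Literature.ModelTheory.ExponentialFields.ExponentialRing.exp τ : ℂ) = -1 := by
    show Complex.exp τ = -1
    rw [hτ]
    exact Complex.exp_pi_mul_I
  have htd : td ⊥ (Submodule.span ℚ {τ}) ≤ 1 := by
    rw [td_span_singleton, pair_comm, hexp,
      (algMatroid ℂ).relRank_insert_eq_of_mem_closure (neg_mem_acl (one_mem_acl _))]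
    exact ((algMatroid ℂ).relRank_le_encard_diff _ _).trans
      ((encard_le_encard sdiff_subset).trans (encard_singleton _).le)
  refine ⟨Submodule.span ℚ {τ}, hVE, hVfg,
    le_antisymm (predim_span_singleton_nonpos_of_td_le_one htd)
      (SplitExact.predim_bot_nonneg hR (hVE.trans span_alg_pi_le_eaFibre) hVfg), ?_⟩
  exact subset_acl _ (mem_gens_of_mem (Submodule.mem_span_singleton_self τ))

/-- Hull of `e^c` for `c` algebraic: the line `ℚc` (`c ∈ acl ∅` gives `td ≤ 1`, so `δ ≤ 0`;
`δ ≥ 0` by (R)). [cite: BaysKirby2018ANT, §9] -/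
theorem exists_hull_exp_of_isAlgebraic (hR : SchanuelOnLogFreeCore) {c : ℂ} (hc : IsAlgebraic ℚ c) :
    ∃ V : Submodule ℚ ℂ, V ≤ Submodule.span ℚ ({z : ℂ | IsAlgebraic ℚ z} ∪ {(Real.pi : ℂ) * Complex.I}) ∧
      IsFG (⊥ : Submodule ℚ ℂ) V ∧ predim ⊥ V = 0 ∧ Complex.exp c ∈ acl (gens V) := by
  have hVE : Submodule.span ℚ {c} ≤
      Submodule.span ℚ ({z : ℂ | IsAlgebraic ℚ z} ∪ {(Real.pi : ℂ) * Complex.I}) :=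
    (Submodule.span_singleton_le_iff_mem _ _).2 (Submodule.subset_span (Or.inl hc))
  have hVfg : IsFG (⊥ : Submodule ℚ ℂ) (Submodule.span ℚ {c}) :=
    isFG_span_of_finite ⊥ (finite_singleton c)
  have htd : td ⊥ (Submodule.span ℚ {c}) ≤ 1 := by
    rw [td_span_singleton,
      (algMatroid ℂ).relRank_insert_eq_of_mem_closure (mem_acl_of_isAlgebraic_rat hc _)]
    exact ((algMatroid ℂ).relRank_le_encard_diff _ _).trans
      ((encard_le_encard sdiff_subset).trans (encard_singleton _).le)
  refine ⟨Submodule.span ℚ {c}, hVE, hVfg,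
    le_antisymm (predim_span_singleton_nonpos_of_td_le_one htd)
      (SplitExact.predim_bot_nonneg hR (hVE.trans span_alg_pi_le_eaFibre) hVfg), ?_⟩
  exact subset_acl _ (exp_mem_gens (Submodule.mem_span_singleton_self c))

/-- Every generator of the π–LW field `L = ℚ(ℚ̄ ∪ {πi} ∪ e^{ℚ̄})` has a hull inside `E`.
[cite: BaysKirby2018ANT, §9] -/
theorem exists_hull_of_mem_gens (hR : SchanuelOnLogFreeCore) {t : ℂ}
    (ht : t ∈ {z : ℂ | IsAlgebraic ℚ z} ∪ {(Real.pi : ℂ) * Complex.I} ∪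
      Complex.exp '' {z : ℂ | IsAlgebraic ℚ z}) :
    ∃ V : Submodule ℚ ℂ, V ≤ Submodule.span ℚ ({z : ℂ | IsAlgebraic ℚ z} ∪ {(Real.pi : ℂ) * Complex.I}) ∧
      IsFG (⊥ : Submodule ℚ ℂ) V ∧ predim ⊥ V = 0 ∧ t ∈ acl (gens V) := by
  rcases ht with (ht | ht) | ⟨c, hc, rfl⟩
  · exact exists_hull_of_isAlgebraic ht
  · rw [mem_singleton_iff] at ht
    rw [ht]
    exact exists_hull_pi_mul_I hR
  · exact exists_hull_exp_of_isAlgebraic hR hc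

/-! ## The count -/

/-- **`(R) ⟹ CoreRel`, transcendence-degree form**: for a core tuple `x` free modulo
`E = span(ℚ̄ ∪ {πi})`, `n ≤ trdeg_L L(x, eˣ)` over the π–LW field `L`.  Hull count: with `J` a
basis of `T = x ∪ eˣ` over the generators `G` of `L` in the algebraic matroid, a finite
`I ⊆ J ∪ G` with `T ⊆ acl I` (finite character) and a common hull `V ≤ E` of `I ∩ G`,
`n = ldim(X/E) ≤ ldim(X/V) ≤ td(X/V) ≤ relRank(T / gens V) ≤ |J| = trdeg_L L(T)`.
[cite: BaysKirby2018ANT, §9] -/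
theorem le_trdeg_of_crux (hR : SchanuelOnLogFreeCore) (n : ℕ) (x : Fin n → ℂ)
    (hx : ∀ i, x i ∈ eaFibre (2 * ↑Real.pi * Complex.I))
    (hli : LinearIndependent ℚ
      ((Submodule.span ℚ ({z : ℂ | IsAlgebraic ℚ z} ∪ {(Real.pi : ℂ) * Complex.I})).mkQ ∘ x)) :
    (n : Cardinal) ≤ Algebra.trdeg
      ↥(IntermediateField.adjoin ℚ ({z : ℂ | IsAlgebraic ℚ z} ∪ {(Real.pi : ℂ) * Complex.I} ∪
        Complex.exp '' {z : ℂ | IsAlgebraic ℚ z}))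
      ↥(IntermediateField.adjoin ↥(IntermediateField.adjoin ℚ ({z : ℂ | IsAlgebraic ℚ z} ∪
        {(Real.pi : ℂ) * Complex.I} ∪ Complex.exp '' {z : ℂ | IsAlgebraic ℚ z}))
        (range x ∪ range (Complex.exp ∘ x))) := by
  set E : Submodule ℚ ℂ := Submodule.span ℚ ({z : ℂ | IsAlgebraic ℚ z} ∪ {(Real.pi : ℂ) * Complex.I})
    with hE
  set G : Set ℂ := {z : ℂ | IsAlgebraic ℚ z} ∪ {(Real.pi : ℂ) * Complex.I} ∪
    Complex.exp '' {z : ℂ | IsAlgebraic ℚ z} with hG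
  set K : IntermediateField ℚ ℂ := IntermediateField.adjoin ℚ G with hK
  set T : Set ℂ := range x ∪ range (Complex.exp ∘ x) with hT
  set X : Submodule ℚ ℂ := Submodule.span ℚ (range x) with hX
  have hTfin : T.Finite := (finite_range x).union (finite_range _)
  have hKG : (algMatroid ℂ).closure (K : Set ℂ) = (algMatroid ℂ).closure G := acl_adjoin G
  -- (1) finite character: a basis `J` of `T` over `G` and a finite `I ⊆ J ∪ G` spanning `T`
  obtain ⟨J, hJ⟩ := ((algMatroid ℂ).contract G).exists_isBasis' T
  have hρ : (algMatroid ℂ).relRank G T = J.encard := by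
    rw [Matroid.relRank_eq_eRk_contract, hJ.encard_eq_eRk]
  have hTclJ : T ⊆ (algMatroid ℂ).closure (J ∪ G) := fun a haT => by
    by_cases haM : a ∈ G
    · exact (algMatroid ℂ).subset_closure _ (fun _ _ => mem_univ _) (Or.inr haM)
    · have haE : a ∈ ((algMatroid ℂ).contract G).E := by
        rw [Matroid.contract_ground]; exact ⟨mem_univ a, haM⟩
      have h1 := ((algMatroid ℂ).contract G).inter_ground_subset_closure T ⟨haT, haE⟩
      rw [← hJ.closure_eq_closure, Matroid.contract_closure_eq] at h1
      exact h1.1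
  obtain ⟨I, hIJG, hIfin, -, hTI⟩ :=
    (algMatroid ℂ).exists_subset_finite_closure_of_subset_closure hTfin hTclJ
  -- (2) a common hull `V ≤ E` of the finitely many generators in `I`
  obtain ⟨V, hV, hVfg, hV0, hcV⟩ := RelLWStep.exists_common_hull hR span_alg_pi_le_eaFibre
    (hIfin.inter_of_left G) fun a ha => exists_hull_of_mem_gens hR ha.2
  -- (3) over `gens V` the set `T` has relative rank `≤ |J| = relRank (T / G)`
  have hle1 : (algMatroid ℂ).relRank (gens V) T ≤ J.encard := by
    have hTcl : T ⊆ (algMatroid ℂ).closure (J ∪ gens V) := by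
      refine hTI.trans ((algMatroid ℂ).closure_subset_closure_of_subset_closure fun a ha => ?_)
      rcases hIJG ha with haJ | haG
      · exact (algMatroid ℂ).subset_closure (J ∪ gens V) (fun _ _ => mem_univ _) (Or.inl haJ)
      · exact (algMatroid ℂ).closure_subset_closure subset_union_right (hcV ⟨ha, haG⟩)
    calc (algMatroid ℂ).relRank (gens V) T ≤ (algMatroid ℂ).relRank (gens V) J :=
          (algMatroid ℂ).relRank_le_of_subset_closure _ hTcl
      _ ≤ (J \ gens V).encard := (algMatroid ℂ).relRank_le_encard_diff _ _
      _ ≤ J.encard := encard_le_encard sdiff_subset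
  -- (4) `td(X/V) ≤ relRank (T / gens V)`; (5) `δ(X/V) ≥ 0`; (6) `ldim(X/V) ≥ ldim(X/E) = n`
  have htdle : td V X ≤ (algMatroid ℂ).relRank (gens V) T := by
    have h := td_span_le_relRank V (range x)
    rw [← range_comp] at h
    exact h
  have hXC : X ≤ Subalgebra.toSubmodule (eaFibre (2 * ↑Real.pi * Complex.I)).toSubalgebra :=
    Submodule.span_le.2 (range_subset_iff.2 hx)
  have hXfg : IsFG (⊥ : Submodule ℚ ℂ) X := isFG_span_of_finite ⊥ (finite_range x)
  have hVXfg : IsFG (⊥ : Submodule ℚ ℂ) (V ⊔ X) := hVfg.sup hXfg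
  have hpVX := SplitExact.predim_bot_nonneg hR (sup_le (hV.trans span_alg_pi_le_eaFibre) hXC) hVXfg
  rw [predim_add bot_le le_sup_left hVXfg, predim_sup_left, hV0, zero_add, predim_def] at hpVX
  have hldimE : ldim E X = n := by
    rw [ldim, hX, Submodule.map_span, ← range_comp, finrank_span_eq_card hli, Fintype.card_fin]
  have hldim : n ≤ ldim V X := by
    have h := ldim_add (inf_le_inf_left X hV) inf_le_left (hXfg.of_le_left bot_le)
    rw [← ldim_eq_ldim_inf X V, ← ldim_eq_ldim_inf X, hldimE] at h
    omega
  -- (7) `n ≤ ldim(X/V) ≤ td(X/V) ≤ relRank (T / gens V) ≤ |J| = relRank (T / G) = trdeg_L L(T)`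
  refine Cardinal.natCast_le_toENat.1 ?_
  rw [toENat_trdeg_adjoin_eq_relRank K T, (algMatroid ℂ).relRank_congr_closure_left T hKG, hρ]
  calc (n : ℕ∞) ≤ ((td V X).toNat : ℕ∞) := ENat.coe_le_coe.2 (by omega)
    _ = td V X := ENat.coe_toNat (td_ne_top (hXfg.of_le_left bot_le))
    _ ≤ J.encard := htdle.trans hle1

end SectorExact

/-- **Registered stub `stub_coreRel_of_crux` of line `sector-split` — exactness of the sector
split: `(R) ⟹ CoreRel`** (signature verbatim).  Under Schanuel's statement on the log-free core,
core tuples that are `ℚ`-linearly independent modulo `span_ℚ(ℚ̄ ∪ {πi})` have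
`trdeg ≥ n` for `K₂(x, eˣ)/K₂`, `K₂ = ℚ(ℚ̄ ∪ {πi} ∪ e^{ℚ̄})` (item stmt-Schanuel-9548 restricted to
the core): `SectorExact.le_trdeg_of_crux`. [cite: BaysKirby2018ANT, §9] -/
theorem stub_coreRel_of_crux :
    Summit.Schanuel.Schanuel.Theses.RigidCore.SchanuelOnLogFreeCore →
    ∀ (n : ℕ) (x : Fin n → ℂ),
      (∀ i, x i ∈ (sInf {K : IntermediateField ℚ ℂ | (2 * ↑Real.pi * Complex.I : ℂ) ∈ K ∧
        (∀ w ∈ K, Complex.exp w ∈ K) ∧ ∀ w : ℂ, IsAlgebraic K w → w ∈ K} : IntermediateField ℚ ℂ)) →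
      LinearIndependent ℚ ((Submodule.span ℚ ({z : ℂ | IsAlgebraic ℚ z} ∪ {(Real.pi : ℂ) * Complex.I})).mkQ ∘ x) →
      (n : Cardinal) ≤ Algebra.trdeg
        ↥(IntermediateField.adjoin ℚ ({z : ℂ | IsAlgebraic ℚ z} ∪ {(Real.pi : ℂ) * Complex.I} ∪ Complex.exp '' {z : ℂ | IsAlgebraic ℚ z}))
        ↥(IntermediateField.adjoin ↥(IntermediateField.adjoin ℚ ({z : ℂ | IsAlgebraic ℚ z} ∪ {(Real.pi : ℂ) * Complex.I} ∪ Complex.exp '' {z : ℂ | IsAlgebraic ℚ z})) (Set.range x ∪ Set.range (Complex.exp ∘ x))) :=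
  fun hR n x hx hli => SectorExact.le_trdeg_of_crux hR n x hx hli

end Summit.Schanuel.Schanuel.Theorems.RigidCore

end
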